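import Literature.NumberTheory.GaloisRepresentations.CrystallineOrdinaryShape
import HarnessLib

/-!
# A triangularisable `ℓ`-adic representation has `det (X - ρ g) = ∏ᵢ det (X - χᵢ g)`
(crux stmt-Langlands-14329 `IrreducibilityBySelfDuality.IrreducibleOffSector`, line `Sketch`;
`--supports` file, lead c8 CONSTITUENT package)

Let `ρ : Γ_K →ₜ* GL_n(ℚ̄_ℓ)` be a framed Galois representation of a number field `K` and suppose a
change of frame `P ρ P⁻¹` (`FramedRep.conj`) is upper triangular (`FramedRep.IsUpperTriangular`).
Its diagonal entries are then continuous characters `χᵢ : Γ_K → ℚ̄_ℓˣ`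
(`FramedRep.IsUpperTriangular.diagChar`; as rank-one framed representations `Γ_K →ₜ* GL_1(ℚ̄_ℓ)` we
use the tree's `diagCharCycTwistFramed i 0`, the twist by the `0`-th power of the cyclotomic
character), and for every `g`
`det (X - ρ g) = det (X - P ρ(g) P⁻¹) = ∏ᵢ (X - χᵢ(g)) = ∏ᵢ det (X - χᵢ(g))`
(conjugation invariance `Matrix.charpoly_units_conj`, the characteristic polynomial of an upper
triangular matrix `Matrix.charpoly_of_upperTriangular`, and `det` of a `1 × 1` matrix).  This is the
linear-algebra input of the corollary "no compatible avatar of a cuspidal `π` (`n ≥ 2`) is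
triangularisable over `ℚ̄_ℓ`" of the lead's theorem excluding `det (X - ρ σ) = ∏ᵢ det (X - χᵢ σ)`.
References: C. W. Curtis, I. Reiner, *Methods of representation theory* I, §16B; N. Bourbaki,
*Algèbre* VIII, §20 (folklore linear algebra).
-/

noncomputable section

set_option linter.dupNamespace false

open Polynomial Matrix
open Literature.NumberTheory.GaloisRepresentations

namespace Summit.Langlands.Langlands.Theorems.IrreducibleOffSector

/-- **Characteristic polynomials of a triangularisable representation factor through the
diagonal characters.**  If `P ρ P⁻¹` is upper triangular for some `P ∈ GL_n(ℚ̄_ℓ)`, then there are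
rank-one framed representations `χ₀, …, χ_{n-1} : Γ_K →ₜ* GL_1(ℚ̄_ℓ)` (the diagonal characters of
`P ρ P⁻¹`) with `det (X - ρ g) = ∏ᵢ det (X - χᵢ g)` for every `g ∈ Γ_K`:
`det (X - ρ g) = det (X - P ρ(g) P⁻¹)` (`Matrix.charpoly_units_conj`) `= ∏ᵢ (X - (P ρ(g) P⁻¹)ᵢᵢ)`
(`Matrix.charpoly_of_upperTriangular`) and `det (X - χᵢ g) = X - χᵢ(g)` for the `1 × 1` matrix
`χᵢ g` (`Matrix.det_fin_one`). [folklore] -/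
theorem exists_charpoly_eq_prod_of_isUpperTriangular {K : Type} [Field K] [NumberField K]
    {ℓ : ℕ} [Fact ℓ.Prime] {n : ℕ}
    (ρ : FramedGaloisRep K (PadicAlgCl ℓ) n) (P : GL (Fin n) (PadicAlgCl ℓ))
    (h : (ρ.conj P).IsUpperTriangular) :
    ∃ χ : Fin n → FramedGaloisRep K (PadicAlgCl ℓ) 1, ∀ g, ρ.charpoly g = ∏ i, (χ i).charpoly g := by
  refine ⟨fun i => h.diagCharCycTwistFramed i 0, fun g => ?_⟩
  -- conjugation invariance of the characteristic polynomial
  have hconj : ρ.charpoly g = (ρ.conj P).charpoly g := by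
    simp only [FramedRep.charpoly, FramedRep.conj_apply, Units.val_mul, Matrix.coe_units_inv]
    exact (Matrix.charpoly_units_conj P _).symm
  -- the characteristic polynomial of the upper triangular matrix `P ρ(g) P⁻¹`
  rw [hconj, FramedRep.charpoly, Matrix.charpoly_of_upperTriangular _
    ((FramedRep.isUpperTriangular_iff_blockTriangular _).1 h g)]
  refine Finset.prod_congr rfl fun i _ => ?_
  -- the characteristic polynomial of the `1 × 1` matrix `χᵢ g = ((P ρ(g) P⁻¹)ᵢᵢ)`
  rw [FramedRep.charpoly, Matrix.charpoly, Matrix.det_fin_one, Matrix.charmatrix_apply_eq,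
    FramedRep.IsUpperTriangular.diagCharCycTwistFramed_apply_val,
    FramedRep.IsUpperTriangular.val_diagCharCycTwist_apply, pow_zero, mul_one,
    FramedRep.diagEntry_apply]

end Summit.Langlands.Langlands.Theorems.IrreducibleOffSector

end
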